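import Mathlib
import HarnessLib

/-!
# THETA certificate, tier 2 input E3 (core): cellwise `L²` bounds — step envelopes on `[0, D]` plus a two-exponential tail (RH-FREE real analysis)

Cell `rh-explicit`, WEIL column, seat weil-1 gen20 (cc-s2-1 gen22 TIER2-KERNEL-SPEC §2 «Stage 2»). The tier-2 kernel bounds the two norms
`A = ‖T⁻‖²`, `B = ‖(T⁻)′‖²` of THETA-CERT-cc6 §E3 by τ-sums of squared CELL envelopes over the depth cells `j < J` (`D = J·τ`) plus closed
exponential tails beyond `D`: `A := 2u₁[τM₀²Σ_j e_j² + M̄²e^{−(2m+1)D}/(2m+1)]`, `B := 2u₁[τΣ_j e′_j² + (M̄/2)²e^{−(2m+1)D}/(2m+1) + M̄M̄₁e^{−2mD}/(2m)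
+ M̄₁²e^{−(2m−1)D}/(2m−1)]`. Both are instances of ONE abstract inequality, proved here with Mathlib only (no theta objects; the change of
variables `x = x₁ − t`, the factor `2u₁` and the envelopes themselves (E1/E2) stay with the blueprint):

**`integral_sq_le_cellSum_add_tail`**: `τ > 0`, `D = J·τ`, `e ≥ 0` with `e t ≤ env j` on the closed cell `[jτ, (j+1)τ]` for `j < J`, and
`e t ≤ P·e^{−κ₁t} + Q·e^{−κ₂t}` for `t > D` (`P, Q ≥ 0`, `κ₁, κ₂ > 0`; no sign needed on `env`), `e²` integrable on `(0, ∞)` ⇒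
`∫_{(0,∞)} e² ≤ τ·Σ_{j<J} env_j² + P²e^{−2κ₁D}/(2κ₁) + 2PQ·e^{−(κ₁+κ₂)D}/(κ₁+κ₂) + Q²e^{−2κ₂D}/(2κ₂)`.

Nothing here bears on the truth of RH.
-/

noncomputable section

set_option linter.dupNamespace false

open MeasureTheory Set Real

namespace Summit.RiemannHypothesis.RiemannHypothesis.Theorems.WeilColumn.ThetaPrime

/-- `∫_{(D,∞)} e^{−c t} dt = e^{−cD}/c` for `c > 0`. [folklore] -/
theorem integral_exp_neg_mul_Ioi' {c : ℝ} (hc : 0 < c) (D : ℝ) :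
    ∫ t in Set.Ioi D, Real.exp (-c * t) = Real.exp (-c * D) / c := by
  have h := integral_exp_mul_Ioi (a := -c) (by linarith) D
  rw [h]; field_simp

/-- Pointwise core of E3 on the cells: for `0 < t ≤ D = J·τ` there is `j < J` with `t` in the closed cell `j`. [folklore] -/
theorem exists_cell_of_pos_le {τ D t : ℝ} {J : ℕ} (hτ : 0 < τ) (hD : D = (J : ℝ) * τ) (ht0 : 0 < t) (htD : t ≤ D) :
    ∃ j < J, (j : ℝ) * τ ≤ t ∧ t ≤ ((j : ℝ) + 1) * τ := by
  have hJ : 0 < J := by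
    rcases Nat.eq_zero_or_pos J with h | h
    · subst h; simp at hD; linarith
    · exact h
  set j : ℕ := min (J - 1) ⌊t / τ⌋₊ with hj
  have hfl : (⌊t / τ⌋₊ : ℝ) ≤ t / τ := Nat.floor_le (div_nonneg ht0.le hτ.le)
  have hfl' : t / τ < (⌊t / τ⌋₊ : ℝ) + 1 := Nat.lt_floor_add_one _
  refine ⟨j, by omega, ?_, ?_⟩
  · have h1 : (j : ℝ) ≤ ⌊t / τ⌋₊ := by exact_mod_cast min_le_right _ _
    have := mul_le_mul_of_nonneg_right (h1.trans hfl) hτ.le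
    rwa [div_mul_cancel₀ _ hτ.ne'] at this
  · rcases le_or_gt ⌊t / τ⌋₊ (J - 1) with h | h
    · have : j = ⌊t / τ⌋₊ := by rw [hj, min_eq_right h]
      rw [this]
      have := mul_le_mul_of_nonneg_right hfl'.le hτ.le
      rwa [div_mul_cancel₀ _ hτ.ne'] at this
    · have : j = J - 1 := by rw [hj, min_eq_left h.le]
      rw [this, Nat.cast_sub hJ, Nat.cast_one, sub_add_cancel, ← hD]
      exact htD

/-- **E3 (core) — CELLWISE `L²` BOUND WITH A TWO-EXPONENTIAL TAIL.** See the module docstring. [TIER2-KERNEL-SPEC §2 E3; folklore] -/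
theorem integral_sq_le_cellSum_add_tail {τ D κ₁ κ₂ P Q : ℝ} {J : ℕ} (hτ : 0 < τ) (hD : D = (J : ℝ) * τ)
    (hκ₁ : 0 < κ₁) (hκ₂ : 0 < κ₂) (hP : 0 ≤ P) (hQ : 0 ≤ Q)
    {e : ℝ → ℝ} {env : ℕ → ℝ} (he0 : ∀ t, 0 ≤ e t)
    (he : ∀ j < J, ∀ t : ℝ, (j : ℝ) * τ ≤ t → t ≤ ((j : ℝ) + 1) * τ → e t ≤ env j)
    (htail : ∀ t : ℝ, D < t → e t ≤ P * Real.exp (-κ₁ * t) + Q * Real.exp (-κ₂ * t))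
    (hint : IntegrableOn (fun t ↦ e t ^ 2) (Set.Ioi 0)) :
    ∫ t in Set.Ioi 0, e t ^ 2 ≤
      τ * ∑ j ∈ Finset.range J, env j ^ 2 +
        (P ^ 2 * Real.exp (-(2 * κ₁) * D) / (2 * κ₁) + 2 * P * Q * Real.exp (-(κ₁ + κ₂) * D) / (κ₁ + κ₂) +
          Q ^ 2 * Real.exp (-(2 * κ₂) * D) / (2 * κ₂)) := by
  have hD0 : 0 ≤ D := by rw [hD]; positivity
  -- the two majorants
  set g : ℝ → ℝ := fun t ↦ ∑ j ∈ Finset.range J, env j ^ 2 * (Set.Icc ((j : ℝ) * τ) (((j : ℝ) + 1) * τ)).indicator 1 t with hg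
  set tail : ℝ → ℝ := fun t ↦ P ^ 2 * Real.exp (-(2 * κ₁) * t) + 2 * P * Q * Real.exp (-(κ₁ + κ₂) * t) +
    Q ^ 2 * Real.exp (-(2 * κ₂) * t) with htaildef
  set h : ℝ → ℝ := (Set.Ioi D).indicator tail with hh
  have hg0 : ∀ t, 0 ≤ g t := fun t ↦ Finset.sum_nonneg fun j _ ↦
    mul_nonneg (sq_nonneg _) (Set.indicator_nonneg (fun _ _ ↦ zero_le_one) _)
  have htail0 : ∀ t, 0 ≤ tail t := fun t ↦ by rw [htaildef]; positivity
  have hh0 : ∀ t, 0 ≤ h t := fun t ↦ Set.indicator_nonneg (fun s _ ↦ htail0 s) _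
  have htail_sq : ∀ t, (P * Real.exp (-κ₁ * t) + Q * Real.exp (-κ₂ * t)) ^ 2 = tail t := by
    intro t
    rw [htaildef]; simp only
    have e1 : Real.exp (-(2 * κ₁) * t) = Real.exp (-κ₁ * t) ^ 2 := by rw [← Real.exp_nat_mul]; ring_nf
    have e2 : Real.exp (-(2 * κ₂) * t) = Real.exp (-κ₂ * t) ^ 2 := by rw [← Real.exp_nat_mul]; ring_nf
    have e3 : Real.exp (-(κ₁ + κ₂) * t) = Real.exp (-κ₁ * t) * Real.exp (-κ₂ * t) := by rw [← Real.exp_add]; ring_nf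
    rw [e1, e2, e3]; ring
  -- pointwise domination on `(0, ∞)`
  have hdom : ∀ t ∈ Set.Ioi (0 : ℝ), e t ^ 2 ≤ g t + h t := by
    intro t ht
    rcases le_or_gt t D with htD | hDt
    · obtain ⟨j, hjJ, h1, h2⟩ := exists_cell_of_pos_le hτ hD ht htD
      have hej : e t ≤ env j := he j hjJ t h1 h2
      have hsq : e t ^ 2 ≤ env j ^ 2 := pow_le_pow_left₀ (he0 t) hej 2
      have hmem : t ∈ Set.Icc ((j : ℝ) * τ) (((j : ℝ) + 1) * τ) := ⟨h1, h2⟩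
      have hle : env j ^ 2 ≤ g t := by
        rw [hg]
        have := Finset.single_le_sum (f := fun i ↦ env i ^ 2 * (Set.Icc ((i : ℝ) * τ) (((i : ℝ) + 1) * τ)).indicator 1 t)
          (fun i _ ↦ mul_nonneg (sq_nonneg _) (Set.indicator_nonneg (fun _ _ ↦ zero_le_one) _)) (Finset.mem_range.2 hjJ)
        simpa [Set.indicator_of_mem hmem] using this
      linarith [hh0 t]
    · have h1 := htail t hDt
      have hsq : e t ^ 2 ≤ (P * Real.exp (-κ₁ * t) + Q * Real.exp (-κ₂ * t)) ^ 2 := pow_le_pow_left₀ (he0 t) h1 2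
      rw [htail_sq] at hsq
      have : h t = tail t := by rw [hh, Set.indicator_of_mem (Set.mem_Ioi.2 hDt)]
      linarith [hg0 t]
  -- integrability of the majorants on `(0, ∞)`
  have hind : ∀ j : ℕ, Integrable (fun t : ℝ ↦ (Set.Icc ((j : ℝ) * τ) (((j : ℝ) + 1) * τ)).indicator (1 : ℝ → ℝ) t) := fun j ↦
    (integrable_indicator_iff measurableSet_Icc).2 (integrableOn_const (by rw [Real.volume_Icc]; exact ENNReal.ofReal_ne_top))
  have hgint : IntegrableOn g (Set.Ioi 0) := by
    rw [hg]
    exact (integrable_finsetSum (Finset.range J) fun j _ ↦ (hind j).const_mul (env j ^ 2)).integrableOn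
  have htailint : IntegrableOn tail (Set.Ioi D) := by
    rw [htaildef]
    refine ((integrableOn_exp_mul_Ioi (by linarith) D |>.const_mul (P ^ 2)).add
      (integrableOn_exp_mul_Ioi (by linarith) D |>.const_mul (2 * P * Q))).add
      (integrableOn_exp_mul_Ioi (by linarith) D |>.const_mul (Q ^ 2))
  have hhint : IntegrableOn h (Set.Ioi 0) := by
    rw [hh]
    exact (htailint.integrable_indicator measurableSet_Ioi).integrableOn
  -- compare
  have hmono : ∫ t in Set.Ioi 0, e t ^ 2 ≤ ∫ t in Set.Ioi 0, (g t + h t) :=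
    setIntegral_mono_on hint (hgint.add hhint) measurableSet_Ioi hdom
  refine hmono.trans ?_
  rw [integral_add hgint hhint]
  gcongr
  · -- the cell part
    have hcell : ∀ j : ℕ, ∫ t in Set.Ioi (0 : ℝ), (Set.Icc ((j : ℝ) * τ) (((j : ℝ) + 1) * τ)).indicator (1 : ℝ → ℝ) t ≤ τ := by
      intro j
      rw [setIntegral_indicator measurableSet_Icc]
      rw [show (fun _ : ℝ ↦ (1 : ℝ → ℝ) _) = fun _ ↦ (1 : ℝ) from rfl, setIntegral_const, smul_eq_mul, mul_one]
      have hvol : volume (Set.Icc ((j : ℝ) * τ) (((j : ℝ) + 1) * τ)) = ENNReal.ofReal τ := by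
        rw [Real.volume_Icc]; congr 1; ring
      calc (volume (Set.Ioi 0 ∩ Set.Icc ((j : ℝ) * τ) (((j : ℝ) + 1) * τ))).toReal
          ≤ (volume (Set.Icc ((j : ℝ) * τ) (((j : ℝ) + 1) * τ))).toReal :=
            ENNReal.toReal_mono (by rw [hvol]; exact ENNReal.ofReal_ne_top) (measure_mono Set.inter_subset_right)
        _ = τ := by rw [hvol, ENNReal.toReal_ofReal hτ.le]
    rw [hg, integral_finsetSum _ (fun j _ ↦ ((hind j).const_mul (env j ^ 2)).integrableOn), Finset.mul_sum]
    refine Finset.sum_le_sum fun j _ ↦ ?_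
    rw [integral_const_mul]
    calc env j ^ 2 * ∫ t in Set.Ioi (0 : ℝ), (Set.Icc ((j : ℝ) * τ) (((j : ℝ) + 1) * τ)).indicator (1 : ℝ → ℝ) t
        ≤ env j ^ 2 * τ := mul_le_mul_of_nonneg_left (hcell j) (sq_nonneg _)
      _ = τ * env j ^ 2 := by ring
  · -- the tail part
    rw [hh, setIntegral_indicator measurableSet_Ioi, Set.inter_eq_right.2 (Set.Ioi_subset_Ioi hD0)]
    have i1 := integrableOn_exp_mul_Ioi (a := -(2 * κ₁)) (by linarith) D
    have i2 := integrableOn_exp_mul_Ioi (a := -(κ₁ + κ₂)) (by linarith) D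
    have i3 := integrableOn_exp_mul_Ioi (a := -(2 * κ₂)) (by linarith) D
    have eI1 := integral_exp_neg_mul_Ioi' (c := 2 * κ₁) (by linarith) D
    have eI2 := integral_exp_neg_mul_Ioi' (c := κ₁ + κ₂) (by linarith) D
    have eI3 := integral_exp_neg_mul_Ioi' (c := 2 * κ₂) (by linarith) D
    have hsum : ∫ x in Set.Ioi D, tail x =
        P ^ 2 * (Real.exp (-(2 * κ₁) * D) / (2 * κ₁)) + 2 * P * Q * (Real.exp (-(κ₁ + κ₂) * D) / (κ₁ + κ₂)) +
          Q ^ 2 * (Real.exp (-(2 * κ₂) * D) / (2 * κ₂)) := by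
      calc ∫ x in Set.Ioi D, tail x
          = (∫ x in Set.Ioi D, (P ^ 2 * Real.exp (-(2 * κ₁) * x) + 2 * P * Q * Real.exp (-(κ₁ + κ₂) * x))) +
              ∫ x in Set.Ioi D, Q ^ 2 * Real.exp (-(2 * κ₂) * x) :=
            integral_add ((i1.const_mul (P ^ 2)).add (i2.const_mul (2 * P * Q))) (i3.const_mul (Q ^ 2))
        _ = ((∫ x in Set.Ioi D, P ^ 2 * Real.exp (-(2 * κ₁) * x)) + ∫ x in Set.Ioi D, 2 * P * Q * Real.exp (-(κ₁ + κ₂) * x)) +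
              ∫ x in Set.Ioi D, Q ^ 2 * Real.exp (-(2 * κ₂) * x) := by
            rw [integral_add (i1.const_mul (P ^ 2)) (i2.const_mul (2 * P * Q))]
        _ = _ := by
            rw [integral_const_mul, integral_const_mul, integral_const_mul, eI1, eI2, eI3]
    rw [hsum]
    apply le_of_eq
    ring

end Summit.RiemannHypothesis.RiemannHypothesis.Theorems.WeilColumn.ThetaPrime

end
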